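import Summits.CriticalPhenomena.PercolationContinuityZ3.Theorems.PercNearOneGluingNoHeavyLowerTailSahiCTCRtThreeHybridReduction
import Summits.CriticalPhenomena.PercolationContinuityZ3.Theorems.PercNearOneGluingNoHeavyLowerTailSahiCTCRtThreeLoopFreeReduction
import HarnessLib

/-!
# `NoHeavyLowerTail` (crux stmt-CriticalPhenomena-4575), P3 lane: THE THREE-POINT DIAGONAL BASE — `[s^{2·1_D}] R_3(𝒳,𝒵) ≥ 0` for `#D = 3`
# by an explicit injection of 3-slot configurations; hence `R_3 ∈ ℕ[s]` for all pairs follows from (EX) at `≤ 1` doubled point and ROW 2 alone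

Support file (seat `prim-l12-p3`, gen 46; `--supports stmt-CriticalPhenomena-4575`).  Memo
`run/shared/lean/prim/prim-l12/FROM-prim-l12-p3-g46-SIGNED-FORM-AND-EX-REFUTED.md` §4b.

`R_3 = Θ₂·(Π·Y_{≥3}) − Θ₂·(X·Z) + Π·(X_{≤2}·Z_{≤2})` and the coefficient of a product of three generating functions at `n` counts the triples of members
`(S,P,Q)` with `1_S + 1_P + 1_Q = n` (`coeff_gf_mul_gf_mul_gf`).  At a profile `n` with entries in `{0,2}` and support `D` of size `3`, every such
triple has all three sets inside `D` and covers each point of `D` exactly twice, so a set of size `3` among them is `D` itself.  The map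
  `(S,P,Q) ↦ (S,P,Q)` (third block) if `#P, #Q ≤ 2`;  `↦ (S,Q,D)` (first block) if `P = D`;  `↦ (D,P,S)` (third block) if `Q = D` and `S = D∖P ∈ 𝒵`;
  `↦ (P,S,D)` (first block) otherwise
injects the triples of the negative block `Θ₂·X·Z` into those of the two positive blocks (`diag_inj_mapsTo`, `diag_inj_injOn`), whence
* **`coeff_Rt_three_nonneg_of_diag_three`** : `0 ≤ coeff_n R_3(𝒳,𝒵)` for up-sets at every profile with entries in `{0,2}` and exactly three doubled points
  (the hypothesis `hB3`/`hB` of `…RtThreeHybridReduction`, `…RtThreeLoopFreeReduction`, `…RtThreeExchangeInduction`, `…RtThreePeelInduction`);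
* **`coeff_Rt_three_nonneg_of_exchangeOne_rowTwo'`** : `R_3 ∈ ℕ[s]` for all pairs of up-sets ⟸ (EX≤1) + ROW 2 (loop-free singles) — no base left;
* **`coeff_Rt_three_nonneg_of_loopFree'`** : `R_3 ∈ ℕ[s]` for all pairs ⟸ the loop-free low rows `hLF` alone.
Nothing is asserted about the crux; (EX≤1), ROW 2, `hLF` are NOT proved here.
-/

noncomputable section

open scoped Classical

namespace Summit.CriticalPhenomena.PercolationContinuityZ3.Theorems.SahiCTCForms

open Finset MvPolynomial SahiCTCGenFun

variable {α : Type*} [DecidableEq α] [Fintype α]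

/-! ### Coefficient of a product of three generating functions -/

omit [Fintype α] in
/-- **`coeff_n (GF(A)·(GF(B)·GF(C)))` = number of triples `(S,P,Q) ∈ A × B × C` with `1_S + 1_P + 1_Q = n`.** [this work] -/
theorem coeff_gf_mul_gf_mul_gf (A B C : Finset (Finset α)) (n : α →₀ ℕ) :
    (gf A * (gf B * gf C)).coeff n = #((A ×ˢ (B ×ˢ C)).filter fun t => ind t.1 + (ind t.2.1 + ind t.2.2) = n) := by
  rw [coeff_gf_mul]
  rw [card_eq_sum_card_fiberwise (f := fun t : Finset α × (Finset α × Finset α) => t.1) (t := A.filter fun S => ind S ≤ n)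
    (fun t ht => by
      rw [mem_coe, mem_filter, mem_product] at ht
      rw [mem_coe, mem_filter]
      exact ⟨ht.1.1, by rw [← ht.2]; exact le_self_add⟩)]
  push_cast
  refine sum_congr rfl fun S hS => ?_
  obtain ⟨-, hSn⟩ := mem_filter.1 hS
  rw [coeff_gf_mul_gf]
  congr 1
  refine (card_bij (fun t _ => t.2) (fun t ht => ?_) (fun t ht t' ht' h => ?_) (fun PQ hPQ => ?_)).symm
  · rw [mem_filter, mem_filter, mem_product] at ht
    obtain ⟨⟨⟨-, hBC⟩, heq⟩, h1⟩ := ht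
    refine mem_filter.2 ⟨hBC, ?_⟩
    rw [← heq, h1, add_tsub_cancel_left]
  · rw [mem_filter] at ht ht'
    exact Prod.ext (ht.2.trans ht'.2.symm) h
  · rw [mem_filter] at hPQ
    refine ⟨(S, PQ), mem_filter.2 ⟨mem_filter.2 ⟨mem_product.2 ⟨(mem_filter.1 hS).1, hPQ.1⟩, ?_⟩, rfl⟩, rfl⟩
    rw [hPQ.2, add_tsub_cancel_of_le hSn]

/-! ### Configurations at a diagonal profile -/

section Diag
variable {n : α →₀ ℕ} (h02 : ∀ i, n i = 0 ∨ n i = 2) {S P Q : Finset α} (heq : ind S + (ind P + ind Q) = n)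

omit [Fintype α] in
include heq in
/-- Pointwise form of `1_S + 1_P + 1_Q = n`. [this work] -/
theorem diag_pt (i : α) :
    (if i ∈ S then 1 else 0) + ((if i ∈ P then 1 else 0) + (if i ∈ Q then 1 else 0)) = n i := by
  have := congrArg (fun f : α →₀ ℕ => f i) heq
  simpa only [Finsupp.add_apply, ind_apply] using this

omit [Fintype α] in
include heq in
/-- The three sets lie in the support. [this work] -/
theorem diag_subset : S ⊆ n.support ∧ P ⊆ n.support ∧ Q ⊆ n.support := by
  refine ⟨fun i hi => ?_, fun i hi => ?_, fun i hi => ?_⟩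
  all_goals
    rw [Finsupp.mem_support_iff]
    have := diag_pt heq i
    rw [if_pos hi] at this
    omega

omit [Fintype α] in
include h02 heq in
/-- If the middle set is the whole support, the outer two are complementary in it. [this work] -/
theorem diag_eq_sdiff_of_mid (hP : P = n.support) : Q = n.support \ S := by
  ext i
  have hpt := diag_pt heq i
  subst hP
  rw [mem_sdiff]
  by_cases hS : i ∈ S <;> by_cases hQ : i ∈ Q <;> by_cases hD : i ∈ n.support <;>
    rcases h02 i with h0 | h2 <;> simp_all

omit [Fintype α] in
include h02 heq in
/-- If the last set is the whole support, the first two are complementary in it. [this work] -/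
theorem diag_eq_sdiff_of_last (hQ : Q = n.support) : S = n.support \ P := by
  have heq' : ind P + (ind Q + ind S) = n := by rw [← heq]; abel
  have := diag_eq_sdiff_of_mid (S := P) (P := Q) (Q := S) h02 heq' hQ
  exact this

end Diag

/-! ### The injection -/

section Inj
variable (F G : Finset (Finset α)) (n : α →₀ ℕ)

/-- The triples of the negative block `Θ₂·X·Z` at `n`. [this work] -/
def diagNeg : Finset (Finset α × (Finset α × Finset α)) :=
  ((bySize (· < 3) : Finset (Finset α)) ×ˢ (F ×ˢ G)).filter fun t => ind t.1 + (ind t.2.1 + ind t.2.2) = n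

/-- The triples of the positive block `Θ₂·Π·Y_{≥3}` at `n`. [this work] -/
def diagPos1 : Finset (Finset α × (Finset α × Finset α)) :=
  ((bySize (· < 3) : Finset (Finset α)) ×ˢ ((univ.powerset : Finset (Finset α)) ×ˢ atLeast 3 (F ∩ G))).filter
    fun t => ind t.1 + (ind t.2.1 + ind t.2.2) = n

/-- The triples of the positive block `Π·X_{≤2}·Z_{≤2}` at `n`. [this work] -/
def diagPos3 : Finset (Finset α × (Finset α × Finset α)) :=
  ((univ.powerset : Finset (Finset α)) ×ˢ (below 3 F ×ˢ below 3 G)).filter fun t => ind t.1 + (ind t.2.1 + ind t.2.2) = n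

/-- The map on triples (see the file header). [this work] -/
def diagMap (t : Finset α × (Finset α × Finset α)) :
    (Finset α × (Finset α × Finset α)) ⊕ (Finset α × (Finset α × Finset α)) :=
  if #t.2.1 ≤ 2 ∧ #t.2.2 ≤ 2 then Sum.inr t
  else if #t.2.1 = 3 then Sum.inl (t.1, (t.2.2, n.support))
  else if n.support \ t.2.1 ∈ G then Sum.inr (n.support, (t.2.1, t.1))
  else Sum.inl (t.2.1, (t.1, n.support))

variable {F G n}
variable (hF : IsUpperSet (F : Set (Finset α))) (hG : IsUpperSet (G : Set (Finset α))) (h02 : ∀ i, n i = 0 ∨ n i = 2)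
  (h3 : #n.support = 3)

/-- Unpacking a negative triple. [this work] -/
theorem mem_diagNeg {t : Finset α × (Finset α × Finset α)} :
    t ∈ diagNeg F G n ↔ #t.1 < 3 ∧ t.2.1 ∈ F ∧ t.2.2 ∈ G ∧ ind t.1 + (ind t.2.1 + ind t.2.2) = n := by
  unfold diagNeg
  simp only [mem_filter, mem_product, bySize, mem_powerset, subset_univ, true_and, and_assoc]

include hF hG h02 h3 in
/-- The map sends negative triples into the disjoint sum of the positive ones. [this work] -/
theorem diag_inj_mapsTo :
    Set.MapsTo (diagMap G n) (diagNeg F G n : Set _) ((diagPos1 F G n).disjSum (diagPos3 F G n) : Set _) := by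
  intro t ht
  rw [mem_coe, mem_diagNeg] at ht
  obtain ⟨hS, hPF, hQG, heq⟩ := ht
  obtain ⟨hSD, hPD, hQD⟩ := diag_subset heq
  have hP3 : #t.2.1 ≤ 3 := h3 ▸ card_le_card hPD
  have hQ3 : #t.2.2 ≤ 3 := h3 ▸ card_le_card hQD
  have hDF : n.support ∈ F := hF hPD hPF
  have hDG : n.support ∈ G := hG hQD hQG
  have hDY : n.support ∈ atLeast 3 (F ∩ G) := by
    unfold atLeast; rw [mem_filter, mem_inter]; exact ⟨⟨hDF, hDG⟩, by omega⟩
  rw [mem_coe]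
  unfold diagMap
  split_ifs with h1 h2 h4
  · -- both small: third block
    rw [inr_mem_disjSum]
    unfold diagPos3
    simp only [mem_filter, mem_product, mem_powerset, subset_univ, true_and, below, and_assoc]
    exact ⟨hPF, by omega, hQG, by omega, heq⟩
  · -- P = D: first block, triple (S, Q, D)
    have hPe : t.2.1 = n.support := eq_of_subset_of_card_le hPD (by omega)
    rw [inl_mem_disjSum]
    unfold diagPos1
    simp only [mem_filter, mem_product, mem_powerset, subset_univ, true_and, bySize, and_assoc]
    refine ⟨hS, hDY, ?_⟩
    calc ind t.1 + (ind t.2.2 + ind n.support) = ind t.1 + (ind t.2.1 + ind t.2.2) := by rw [hPe]; abel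
      _ = n := heq
  · -- Q = D and D \ P ∈ G: third block, triple (D, P, S)
    have hQe : t.2.2 = n.support := eq_of_subset_of_card_le hQD (by omega)
    have hSe : t.1 = n.support \ t.2.1 := diag_eq_sdiff_of_last h02 heq hQe
    rw [inr_mem_disjSum]
    unfold diagPos3
    simp only [mem_filter, mem_product, mem_powerset, subset_univ, true_and, below, and_assoc]
    refine ⟨hPF, by omega, hSe ▸ h4, hS, ?_⟩
    calc ind n.support + (ind t.2.1 + ind t.1) = ind t.1 + (ind t.2.1 + ind t.2.2) := by rw [hQe]; abel
      _ = n := heq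
  · -- Q = D and D \ P ∉ G: first block, triple (P, S, D)
    have hQe : t.2.2 = n.support := eq_of_subset_of_card_le hQD (by omega)
    rw [inl_mem_disjSum]
    unfold diagPos1
    simp only [mem_filter, mem_product, mem_powerset, subset_univ, true_and, bySize, and_assoc]
    refine ⟨by omega, hDY, ?_⟩
    calc ind t.2.1 + (ind t.1 + ind n.support) = ind t.1 + (ind t.2.1 + ind t.2.2) := by rw [hQe]; abel
      _ = n := heq

include h02 h3 in
/-- The map is injective on the negative triples. [this work] -/
theorem diag_inj_injOn : Set.InjOn (diagMap G n) (diagNeg F G n : Set _) := by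
  intro t ht t' ht' h
  rw [mem_coe, mem_diagNeg] at ht ht'
  obtain ⟨hS, hPF, hQG, heq⟩ := ht
  obtain ⟨hS', hPF', hQG', heq'⟩ := ht'
  obtain ⟨hSD, hPD, hQD⟩ := diag_subset heq
  obtain ⟨hSD', hPD', hQD'⟩ := diag_subset heq'
  have hP3 : #t.2.1 ≤ 3 := h3 ▸ card_le_card hPD
  have hQ3 : #t.2.2 ≤ 3 := h3 ▸ card_le_card hQD
  have hP3' : #t'.2.1 ≤ 3 := h3 ▸ card_le_card hPD'
  have hQ3' : #t'.2.2 ≤ 3 := h3 ▸ card_le_card hQD'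
  -- set equalities available in the non-small branches
  have hPe : ¬ (#t.2.1 ≤ 2 ∧ #t.2.2 ≤ 2) → #t.2.1 = 3 → t.2.1 = n.support := fun _ h =>
    eq_of_subset_of_card_le hPD (by omega)
  have hQe : ¬ (#t.2.1 ≤ 2 ∧ #t.2.2 ≤ 2) → ¬ #t.2.1 = 3 → t.2.2 = n.support := fun h h' =>
    eq_of_subset_of_card_le hQD (by omega)
  have hPe' : ¬ (#t'.2.1 ≤ 2 ∧ #t'.2.2 ≤ 2) → #t'.2.1 = 3 → t'.2.1 = n.support := fun _ h =>
    eq_of_subset_of_card_le hPD' (by omega)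
  have hQe' : ¬ (#t'.2.1 ≤ 2 ∧ #t'.2.2 ≤ 2) → ¬ #t'.2.1 = 3 → t'.2.2 = n.support := fun h h' =>
    eq_of_subset_of_card_le hQD' (by omega)
  -- the four evaluation forms of the map
  have ev1 : ∀ {x : Finset α × (Finset α × Finset α)}, (#x.2.1 ≤ 2 ∧ #x.2.2 ≤ 2) → diagMap G n x = Sum.inr x :=
    fun {x} hx => by unfold diagMap; rw [if_pos hx]
  have ev2 : ∀ {x : Finset α × (Finset α × Finset α)}, ¬ (#x.2.1 ≤ 2 ∧ #x.2.2 ≤ 2) → #x.2.1 = 3 →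
      diagMap G n x = Sum.inl (x.1, (x.2.2, n.support)) := fun {x} hx hx' => by unfold diagMap; rw [if_neg hx, if_pos hx']
  have ev3 : ∀ {x : Finset α × (Finset α × Finset α)}, ¬ (#x.2.1 ≤ 2 ∧ #x.2.2 ≤ 2) → ¬ #x.2.1 = 3 → n.support \ x.2.1 ∈ G →
      diagMap G n x = Sum.inr (n.support, (x.2.1, x.1)) := fun {x} hx hx' hx'' => by
    unfold diagMap; rw [if_neg hx, if_neg hx', if_pos hx'']
  have ev4 : ∀ {x : Finset α × (Finset α × Finset α)}, ¬ (#x.2.1 ≤ 2 ∧ #x.2.2 ≤ 2) → ¬ #x.2.1 = 3 → n.support \ x.2.1 ∉ G →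
      diagMap G n x = Sum.inl (x.2.1, (x.1, n.support)) := fun {x} hx hx' hx'' => by
    unfold diagMap; rw [if_neg hx, if_neg hx', if_neg hx'']
  have hSne : t.1 ≠ n.support := fun h' => by rw [h'] at hS; omega
  have hSne' : t'.1 ≠ n.support := fun h' => by rw [h'] at hS'; omega
  by_cases a1 : #t.2.1 ≤ 2 ∧ #t.2.2 ≤ 2
  · rw [ev1 a1] at h
    by_cases b1 : #t'.2.1 ≤ 2 ∧ #t'.2.2 ≤ 2
    · rw [ev1 b1] at h; exact Sum.inr_injective h
    · by_cases b2 : #t'.2.1 = 3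
      · rw [ev2 b1 b2] at h; exact absurd h Sum.inr_ne_inl
      · by_cases b3 : n.support \ t'.2.1 ∈ G
        · rw [ev3 b1 b2 b3] at h
          exact absurd (Prod.ext_iff.1 (Sum.inr_injective h)).1 hSne
        · rw [ev4 b1 b2 b3] at h; exact absurd h Sum.inr_ne_inl
  · by_cases a2 : #t.2.1 = 3
    · rw [ev2 a1 a2] at h
      by_cases b1 : #t'.2.1 ≤ 2 ∧ #t'.2.2 ≤ 2
      · rw [ev1 b1] at h; exact absurd h Sum.inl_ne_inr
      · by_cases b2 : #t'.2.1 = 3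
        · -- (S, Q, D) = (S', Q', D)
          rw [ev2 b1 b2] at h
          obtain ⟨h1, h2⟩ := Prod.ext_iff.1 (Sum.inl_injective h)
          exact Prod.ext h1 (Prod.ext ((hPe a1 a2).trans (hPe' b1 b2).symm) (Prod.ext_iff.1 h2).1)
        · by_cases b3 : n.support \ t'.2.1 ∈ G
          · rw [ev3 b1 b2 b3] at h; exact absurd h Sum.inl_ne_inr
          · -- (S, Q, D) = (P', S', D): then Q = S' = D \ P' ∈ G, contradiction
            rw [ev4 b1 b2 b3] at h
            obtain ⟨-, h2⟩ := Prod.ext_iff.1 (Sum.inl_injective h)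
            have hQS : t.2.2 = t'.1 := (Prod.ext_iff.1 h2).1
            have hSe' : t'.1 = n.support \ t'.2.1 := diag_eq_sdiff_of_last h02 heq' (hQe' b1 b2)
            exact absurd (hSe' ▸ hQS ▸ hQG) b3
    · by_cases a3 : n.support \ t.2.1 ∈ G
      · rw [ev3 a1 a2 a3] at h
        by_cases b1 : #t'.2.1 ≤ 2 ∧ #t'.2.2 ≤ 2
        · rw [ev1 b1] at h
          exact absurd (Prod.ext_iff.1 (Sum.inr_injective h)).1.symm hSne'
        · by_cases b2 : #t'.2.1 = 3
          · rw [ev2 b1 b2] at h; exact absurd h Sum.inr_ne_inl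
          · by_cases b3 : n.support \ t'.2.1 ∈ G
            · -- (D, P, S) = (D, P', S')
              rw [ev3 b1 b2 b3] at h
              obtain ⟨-, h2⟩ := Prod.ext_iff.1 (Sum.inr_injective h)
              obtain ⟨hPP, hSS⟩ := Prod.ext_iff.1 h2
              exact Prod.ext hSS (Prod.ext hPP ((hQe a1 a2).trans (hQe' b1 b2).symm))
            · rw [ev4 b1 b2 b3] at h; exact absurd h Sum.inr_ne_inl
      · rw [ev4 a1 a2 a3] at h
        by_cases b1 : #t'.2.1 ≤ 2 ∧ #t'.2.2 ≤ 2
        · rw [ev1 b1] at h; exact absurd h Sum.inl_ne_inr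
        · by_cases b2 : #t'.2.1 = 3
          · -- (P, S, D) = (S', Q', D): symmetric contradiction
            rw [ev2 b1 b2] at h
            obtain ⟨-, h2⟩ := Prod.ext_iff.1 (Sum.inl_injective h)
            have hSQ : t.1 = t'.2.2 := (Prod.ext_iff.1 h2).1
            have hSe : t.1 = n.support \ t.2.1 := diag_eq_sdiff_of_last h02 heq (hQe a1 a2)
            exact absurd (hSe ▸ hSQ ▸ hQG') a3
          · by_cases b3 : n.support \ t'.2.1 ∈ G
            · rw [ev3 b1 b2 b3] at h; exact absurd h Sum.inl_ne_inr
            · -- (P, S, D) = (P', S', D)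
              rw [ev4 b1 b2 b3] at h
              obtain ⟨hPP, h2⟩ := Prod.ext_iff.1 (Sum.inl_injective h)
              exact Prod.ext (Prod.ext_iff.1 h2).1 (Prod.ext hPP ((hQe a1 a2).trans (hQe' b1 b2).symm))

end Inj

/-! ### The base and the base-free reductions -/

/-- **THE THREE-POINT DIAGONAL**: for up-sets `𝒳, 𝒵` and a profile `n` with entries in `{0,2}` and exactly three doubled points,
`0 ≤ coeff_n R_3(𝒳,𝒵)` — the negative 3-slot configurations inject into the positive ones (memo g46 §4b). [this work] -/
theorem coeff_Rt_three_nonneg_of_diag_three {F G : Finset (Finset α)} (hF : IsUpperSet (F : Set (Finset α)))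
    (hG : IsUpperSet (G : Set (Finset α))) {n : α →₀ ℕ} (h02 : ∀ i, n i = 0 ∨ n i = 2) (h3 : #(dbl n) = 3) :
    0 ≤ (Rt 3 F G).coeff n := by
  have hsupp : dbl n = n.support := by
    unfold dbl; ext i; simp only [mem_filter, Finsupp.mem_support_iff, and_iff_left_iff_imp]
    intro h; exact (h02 i).resolve_left h
  rw [hsupp] at h3
  have hneg : (gf (bySize (· < 3) : Finset (Finset α)) * (gf F * gf G)).coeff n = (#(diagNeg F G n) : ℤ) := by
    rw [coeff_gf_mul_gf_mul_gf]; rfl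
  have hpos1 : (gf (bySize (· < 3) : Finset (Finset α)) * (PiP * gf (atLeast 3 (F ∩ G)))).coeff n = (#(diagPos1 F G n) : ℤ) := by
    unfold PiP; rw [coeff_gf_mul_gf_mul_gf]; rfl
  have hpos3 : ((PiP : MvPolynomial α ℤ) * (gf (below 3 F) * gf (below 3 G))).coeff n = (#(diagPos3 F G n) : ℤ) := by
    unfold PiP; rw [coeff_gf_mul_gf_mul_gf]; rfl
  have hle : #(diagNeg F G n) ≤ #(diagPos1 F G n) + #(diagPos3 F G n) := by
    rw [← card_disjSum]
    exact card_le_card_of_injOn (diagMap G n) (diag_inj_mapsTo hF hG h02 h3) (diag_inj_injOn h02 h3)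
  unfold Rt
  rw [mul_sub, coeff_add, coeff_sub, hneg, hpos1, hpos3]
  have : (#(diagNeg F G n) : ℤ) ≤ #(diagPos1 F G n) + #(diagPos3 F G n) := by exact_mod_cast hle
  linarith

/-- **`R_3 ∈ ℕ[s]` FROM (EX≤1) AND ROW 2 ALONE** (the three-point diagonal of `coeff_Rt_three_nonneg_of_exchangeOne_rowTwo` discharged). [this work] -/
theorem coeff_Rt_three_nonneg_of_exchangeOne_rowTwo'
    (hEX1 : ∀ (F G : Finset (Finset α)), IsUpperSet (F : Set (Finset α)) → IsUpperSet (G : Set (Finset α)) →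
      ∀ (n : α →₀ ℕ) (s u : α), s ≠ u → n s = 1 → n u = 1 → (∀ i, n i ≤ 2) → #(dbl n) ≤ 1 →
        (∀ w, n w = 1 → ({w} : Finset α) ∉ F ∧ ({w} : Finset α) ∉ G) →
        (Rt 3 F G).coeff (n - Finsupp.single u 1 + Finsupp.single s 1) ≤ (Rt 3 F G).coeff n)
    (hR2 : ∀ (F G : Finset (Finset α)), IsUpperSet (F : Set (Finset α)) → IsUpperSet (G : Set (Finset α)) →
      ∀ (n : α →₀ ℕ), (∀ i, n i ≤ 2) → #(dbl n) = 2 → (∃ s, n s = 1) →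
        (∀ w, n w = 1 → ({w} : Finset α) ∉ F ∧ ({w} : Finset α) ∉ G) → 0 ≤ (Rt 3 F G).coeff n)
    {F G : Finset (Finset α)} (hF : IsUpperSet (F : Set (Finset α))) (hG : IsUpperSet (G : Set (Finset α))) (n : α →₀ ℕ) :
    0 ≤ (Rt 3 F G).coeff n :=
  coeff_Rt_three_nonneg_of_exchangeOne_rowTwo hEX1 hR2
    (fun _ _ hF' hG' _ hm h3 => coeff_Rt_three_nonneg_of_diag_three hF' hG' hm h3) hF hG n

/-- **`R_3 ∈ ℕ[s]` FROM THE LOOP-FREE LOW ROWS ALONE** (the diagonal base of `coeff_Rt_three_nonneg_of_loopFree` discharged: supports of size `≤ 2`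
vanish and the three-point diagonal is `coeff_Rt_three_nonneg_of_diag_three`). [this work] -/
theorem coeff_Rt_three_nonneg_of_loopFree'
    (hLF : ∀ (F G : Finset (Finset α)), IsUpperSet (F : Set (Finset α)) → IsUpperSet (G : Set (Finset α)) →
      ∀ (n : α →₀ ℕ), (∀ i, n i ≤ 2) → #(dbl n) ≤ 2 → (∃ s, n s = 1) →
        (∀ u, n u = 1 → ({u} : Finset α) ∉ F ∧ ({u} : Finset α) ∉ G) → 0 ≤ (Rt 3 F G).coeff n)
    {F G : Finset (Finset α)} (hF : IsUpperSet (F : Set (Finset α))) (hG : IsUpperSet (G : Set (Finset α))) (n : α →₀ ℕ) :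
    0 ≤ (Rt 3 F G).coeff n := by
  refine coeff_Rt_three_nonneg_of_loopFree hLF (fun F' G' hF' hG' m hm h3 => ?_) hF hG n
  by_cases h : #(dbl m) = 3
  · exact coeff_Rt_three_nonneg_of_diag_three hF' hG' hm h
  · have hsupp : dbl m = m.support := by
      unfold dbl; ext i; simp only [mem_filter, Finsupp.mem_support_iff, and_iff_left_iff_imp]
      intro h'; exact (hm i).resolve_left h'
    rw [coeff_Rt_three_eq_zero_of_card_support_le_two F' G' (by rw [← hsupp]; omega)]

end Summit.CriticalPhenomena.PercolationContinuityZ3.Theorems.SahiCTCForms
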